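import Mathlib

/-!
# TwoAdicLadder — crux `TwoIntegralNormalisation` (stmt-ValiantsHypothesis-5947):
# ARITHMETIC SPECIALISATION, part 1 — Noether coordinates of the fibre at `2`

Support lemmas (pure commutative algebra) for the calibration `TwoIntegralNormalisation ⟺
HalfElimGlobal`. For a finitely generated `ℤ`-algebra `B` in which `2` is not a unit:

* `exists_eq_C_two_mul_of_map_eq_zero`, `injective_aeval_of_injective_mod_two` — `2`-adic descent
  on the coefficients of integer polynomials: if every integer polynomial vanishing at `t : Fin e → B`
  modulo `2` has even coefficients and `B` has no `2`-torsion, then `ℤ[X₁,…,X_e] → B`, `X ↦ t`, is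
  injective.
* `exists_noether_lift` — Noether normalisation of the fibre `B ⧸ 2B` over `𝔽₂` (Mathlib
  `exists_finite_inj_algHom_of_fg`), lifted to `B`: coordinates `t : Fin e → B` such that
  `ℤ[X] → B` is injective modulo `2` and `B ⧸ 2B` is module-finite over `ℤ[X]`.

Part 2 (`…LocalPoints.lean`) turns this into a ring homomorphism `B → 𝓞_(P')`, `P' ∋ 2`, for a
number field, via Zariski's Main Theorem and going down. Honest framing: folklore commutative
algebra recorded as a helper; nothing here is progress on VP ≠ VNP.
-/

noncomputable section

open MvPolynomial

-- the summit and the problem share the name `ValiantsHypothesis` (D-0017 single-conjunct layout)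
set_option linter.dupNamespace false

namespace Summit.ValiantsHypothesis.ValiantsHypothesis.Theorems.TwoAdicLadder.TwoIntegralNormalisation

/-! ### `2`-adic descent on the coefficients of integer polynomials -/

section Descent

variable {e : ℕ}

/-- An integer polynomial all of whose coefficients are even is `2 ·` an integer polynomial.
[folklore] -/
theorem exists_eq_C_two_mul_of_map_eq_zero (l : MvPolynomial (Fin e) ℤ)
    (h : MvPolynomial.map (Int.castRingHom (ZMod 2)) l = 0) :
    ∃ μ : MvPolynomial (Fin e) ℤ, l = C 2 * μ := by
  classical
  have hdvd : ∀ m, (2 : ℤ) ∣ coeff m l := by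
    intro m
    have hm := congrArg (coeff m) h
    rw [coeff_map, coeff_zero, eq_intCast] at hm
    exact (ZMod.intCast_zmod_eq_zero_iff_dvd _ 2).1 hm
  refine ⟨∑ m ∈ l.support, monomial m (coeff m l / 2), ?_⟩
  ext m
  rw [coeff_C_mul, coeff_sum]
  simp only [coeff_monomial]
  rw [Finset.sum_ite_eq' l.support m]
  split_ifs with hm
  · exact (Int.mul_ediv_cancel' (hdvd m)).symm
  · rw [mul_zero]; exact notMem_support_iff.1 hm

/-- **Injectivity of lifted Noether coordinates.** Let `t : Fin e → B` be elements of a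
commutative ring `B` without `2`-torsion such that every integer polynomial vanishing at `t`
modulo `2` has all its coefficients even. Then no non-zero integer polynomial vanishes at `t`:
by `2`-adic descent, a polynomial in the kernel is divisible by every power of `2`. [folklore] -/
theorem injective_aeval_of_injective_mod_two {B : Type*} [CommRing B] (t : Fin e → B)
    (h2 : ∀ b : B, 2 * b = 0 → b = 0)
    (hinj : ∀ l : MvPolynomial (Fin e) ℤ, aeval t l ∈ Ideal.span {(2 : B)} →
      MvPolynomial.map (Int.castRingHom (ZMod 2)) l = 0) :
    Function.Injective (aeval t : MvPolynomial (Fin e) ℤ →ₐ[ℤ] B) := by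
  rw [injective_iff_map_eq_zero]
  intro l hl
  -- `l = 2^N μ_N` with `aeval t μ_N = 0`, for every `N`
  have key : ∀ N : ℕ, ∃ μ : MvPolynomial (Fin e) ℤ, l = C ((2 : ℤ) ^ N) * μ ∧ aeval t μ = 0 := by
    intro N
    induction N with
    | zero => exact ⟨l, by simp, hl⟩
    | succ N ih =>
      obtain ⟨μ, hμ, hμ0⟩ := ih
      have hmem : aeval t μ ∈ Ideal.span {(2 : B)} := by rw [hμ0]; exact Ideal.zero_mem _
      obtain ⟨μ', hμ'⟩ := exists_eq_C_two_mul_of_map_eq_zero μ (hinj μ hmem)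
      refine ⟨μ', ?_, ?_⟩
      · rw [hμ, hμ', ← mul_assoc, ← C_mul, pow_succ]
      · apply h2
        have : aeval t μ = 2 * aeval t μ' := by
          rw [hμ', map_mul, aeval_C]; simp
        rw [← this, hμ0]
  ext m
  rw [coeff_zero]
  obtain ⟨μ, hμ, -⟩ := key (coeff m l).natAbs
  have hdvd : (2 : ℤ) ^ (coeff m l).natAbs ∣ coeff m l := by
    conv_rhs => rw [hμ]
    rw [coeff_C_mul]
    exact Dvd.intro _ rfl
  refine Int.eq_zero_of_dvd_of_natAbs_lt_natAbs hdvd ?_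
  rw [Int.natAbs_pow]
  exact Nat.lt_two_pow_self

end Descent

/-! ### Noether coordinates of the fibre, lifted -/

section Main

variable {B : Type} [CommRing B] [IsDomain B] [CharZero B] [Algebra.FiniteType ℤ B]

omit [IsDomain B] [CharZero B] in
/-- Stage 1 (Noether coordinates of the fibre at `2`, lifted). If `2` is not a unit of the
finitely generated `ℤ`-domain `B`, there are `e` and `t : Fin e → B` such that the evaluation
`ℤ[X₁,…,X_e] → B` at `t` is injective modulo `2` (an integer polynomial vanishing at `t`
modulo `2B` has even coefficients) and `B ⧸ 2B` is module-finite over `ℤ[X₁,…,X_e]` along it.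
[folklore] -/
theorem exists_noether_lift (h2 : ¬ IsUnit (2 : B)) :
    ∃ (e : ℕ) (t : Fin e → B),
      (∀ l : MvPolynomial (Fin e) ℤ, aeval t l ∈ Ideal.span {(2 : B)} →
        MvPolynomial.map (Int.castRingHom (ZMod 2)) l = 0) ∧
      ((Ideal.Quotient.mk (Ideal.span {(2 : B)})).comp
        (aeval t : MvPolynomial (Fin e) ℤ →ₐ[ℤ] B).toRingHom).Finite := by
  classical
  -- the fibre `B ⧸ 2B`, an `𝔽₂`-algebra of finite type
  set I : Ideal B := Ideal.span {(2 : B)} with hI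
  have hI2 : ((2 : ℕ) : B) ∈ nonunits B := by simpa using h2
  haveI : Fact (Nat.Prime 2) := ⟨Nat.prime_two⟩
  haveI : CharP (B ⧸ I) 2 := by
    have := CharP.quotient B 2 hI2
    simpa [hI] using this
  haveI : Nontrivial (B ⧸ I) := CharP.nontrivial_of_char_ne_one (R := B ⧸ I) (by norm_num : (2:ℕ) ≠ 1)
  letI : Algebra (ZMod 2) (B ⧸ I) := ZMod.algebra _ 2
  haveI : Algebra.FiniteType ℤ (B ⧸ I) := Algebra.FiniteType.trans (S := B) inferInstance
    (Algebra.FiniteType.of_surjective (Algebra.ofId B (B ⧸ I)) Ideal.Quotient.mk_surjective)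
  haveI : Algebra.FiniteType (ZMod 2) (B ⧸ I) := by
    obtain ⟨s, hs⟩ := ‹Algebra.FiniteType ℤ (B ⧸ I)›
    refine ⟨s, top_le_iff.mp fun x _ => ?_⟩
    have hx : x ∈ Algebra.adjoin ℤ (s : Set (B ⧸ I)) := hs ▸ trivial
    refine Algebra.adjoin_induction (fun y hy => Algebra.subset_adjoin hy) (fun n => ?_)
      (fun _ _ _ _ h1 h2 => add_mem h1 h2) (fun _ _ _ _ h1 h2 => mul_mem h1 h2) hx
    exact Subalgebra.intCast_mem _ n
  -- Noether normalisation of the fibre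
  obtain ⟨e, g, hg, hgfin⟩ := exists_finite_inj_algHom_of_fg (ZMod 2) (B ⧸ I)
  -- lift the coordinates
  choose t ht using fun i => Ideal.Quotient.mk_surjective (I := I) (g (X i))
  -- the square `Λ → B → B ⧸ 2B` = `Λ → 𝔽₂[X] → B ⧸ 2B`
  have hsq : (Ideal.Quotient.mk I).comp (aeval t : MvPolynomial (Fin e) ℤ →ₐ[ℤ] B).toRingHom =
      g.toRingHom.comp (MvPolynomial.map (Int.castRingHom (ZMod 2))) := by
    refine MvPolynomial.ringHom_ext (fun n => ?_) (fun i => ?_)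
    · simp only [AlgHom.toRingHom_eq_coe, eq_intCast, map_intCast]
    · simp only [RingHom.coe_comp, Function.comp_apply, AlgHom.toRingHom_eq_coe, RingHom.coe_coe,
        MvPolynomial.aeval_X, MvPolynomial.map_X]
      exact ht i
  refine ⟨e, t, fun l hl => ?_, ?_⟩
  · apply hg
    rw [map_zero]
    have := RingHom.congr_fun hsq l
    have this' : g (MvPolynomial.map (Int.castRingHom (ZMod 2)) l) =
        Ideal.Quotient.mk I (aeval t l) := by simpa using this.symm
    rw [this']
    exact Ideal.Quotient.eq_zero_iff_mem.2 (by simpa [hI] using hl)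
  · rw [hsq]
    exact RingHom.Finite.comp hgfin (RingHom.Finite.of_surjective _
      (MvPolynomial.map_surjective _ (ZMod.ringHom_surjective (Int.castRingHom (ZMod 2)))))

omit [Algebra.FiniteType ℤ B] in
/-- In a domain of characteristic `0` there is no `2`-torsion. [folklore] -/
theorem eq_zero_of_two_mul_eq_zero (b : B) (hb : 2 * b = 0) : b = 0 := by
  rcases mul_eq_zero.1 hb with h | h
  · exact absurd h two_ne_zero
  · exact h

end Main

end Summit.ValiantsHypothesis.ValiantsHypothesis.Theorems.TwoAdicLadder.TwoIntegralNormalisation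

end
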